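import Summits.BirchSwinnertonDyer.BirchSwinnertonDyer.Theorems.PrintX11aLowerHalfThreeKodairaMemberByName
import Summits.BirchSwinnertonDyer.Rank1Residual.X11a.Cells
import Literature.NumberTheory.EllipticCurves.Wuthrich2014.ThreeAdicImageSupersingularProofs
import HarnessLib

/-!
# Crux `X11aLowerHalf` (item stmt-BirchSwinnertonDyer-19064), `p = 3`: the registered open-core stub
# `stub_lowerTresRamifieThree` of line birth r8 — its normal form, its leaner fact list, and its two
# research-currency doors («a member with the rational cyclotomic equality» ∕ «X. Wan's Thm. 4 shape at 3»)
# (`--supports stmt-BirchSwinnertonDyer-19064` helper; seat bsd-line-er5-p2 = -w3 width seat of the 19064 line)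

HONEST FRAMING. Theorems only; no definition, no named fact, no `sorry`; NO route file imported. Nothing here
closes the crux or the stub: the très-ramifié off-Kodaira deep X11a locus at `p = 3` (in range: 286 of the 448 deep
X11a classes with `N < 5·10⁵`, all with `ρ̄_{E,3}` onto) carries NO printed lower-bound statement — Skinner–Urban 3.6.4
needs a (ram) prime `q ≠ 3` (none: `¬Ram`, and off the Kodaira sub-locus no member of `H(E[3])` acquires one), X. Wan's
Thm. 4 ∕ Thm. 103 print «`p ⩾ 5`» (Hung's non-vanishing theorem and (H1) exclude `3`), a good-reduction partner is
impossible (a good `A[3]` is finite flat at `3`), the Kolyvagin-system roads (W. Zhang 2014, Sweeting 2020, Kim 2022 ∕ AJM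
2026, Burungale–Castella–Grossi–Skinner 2023) print «`p ≥ 5`» ∕ good ordinary, Greenberg–Vatsal's Artin theory (the
Langlands–Tunnell weight-one member) needs `p ∤ [K:ℚ] = 48`. Every theorem below is CONDITIONAL on displayed named facts
and ONE displayed `∀`-statement on that locus which is NOT in print. BSD is not proved for any curve or class by this
file; no summit statement is proved by this seat. beyond-print theorem: no.

## What

* `tresRamifieThree_iff_offKodaira` — on the locus `Surj W 3` is automatic (`3 ∤ ord₃ Δ_min`: Tate's transvection, the
  tree theorem `ClassX11a.surj_of_not_dvd`), so the stub's binder `¬ (Surj W p ∧ Kodaira)` is just `¬ Kodaira`: the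
  registered statement ⇔ its `Surj`-free normal form (pure logic).
* `ClassX11a.missingLowerBoundAt_three_of_tresRamifie_of_memberRatEqAt_of_facts` — AT A PAIR on the locus:
  `OddChain.MemberRatEqAt W 3` + THIRTEEN named facts (not the 21 of the both-images door
  `ClassX11a.missingLowerBoundAt_three_of_mazur_of_memberRatEqAt_of_facts`, p617929: the non-surjective Kato §17.13
  branch is vacuous here) ⟹ `Typed.MissingLowerBoundAt W 3`.
* `tresRamifieThree_of_forall_memberRatEqAt_of_facts` — **the registered r8 stub `stub_lowerTresRamifieThree`, ITS
  STATEMENT VERBATIM, from the 13 facts + Greenberg–Stevens + ONE `∀`-hypothesis: «`MemberRatEqAt W 3` at every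
  très-ramifié off-Kodaira deep X11a pair at `3`»** (binders identical to the stub's).
* `tresRamifieThree_of_wanShapeThree_of_facts` — the same from the 13 facts + «X. Wan's Thm. 4 conclusion at `p = 3`
  for every good-ordinary member of `H(E[3])`, `E` multiplicative and très ramifié at `3` with `E[3]` irreducible»
  (the fact `Wan2015.thm4_rational_weightK_member_of_bdd_ofLevel_irred` with its binder `5 ≤ p` replaced by
  `p = 3 ∧ 3 ∤ ord₃ Δ_min` — NOT a theorem in print; displayed as a hypothesis, never as a fact); the member is the
  weight-six one of `OddChain.exists_memberOfLevel_three` (modularity).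

So the open core of crux `X11aLowerHalf` at `p = 3` is, in the kernel, EXACTLY ONE research statement in either
currency, and a future proof of either closes the registered stub in one line through this file.

References: [Wan2015] Thm. 4 (p. 4, "Suppose that p ⩾ 5"), Thm. 86 (p. 70), Lemma 87, Thm. 103 (p. 91);
[SkinnerUrban2014] Thm. 3.6.4 (p. 43), Prop. 12.3.6 (p. 202); [EmertonPollackWeston2006] Thm. 1, 3.1.1, 5.1.3, p. 5;
[Wuthrich2014] Thm. 3, Cor. 19, Lemma 20 (p. 399); [Mazur1978] Cor. 4.1; [Miller2011LMS] Def. 1.1;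
[SilvermanATAEC1994] V.6 Prop. 6.1; Kim, AJM 2026 = arXiv:2203.12159 §1.2.5 («p ≥ 5 … it seems possible to extend to
the p = 3 case», not done there); Greenberg–Vatsal, ASPM 86 (2020) Hypothesis A; cell files
`pub/bsd-stepL/line-er5-p2/P3-LOWER-AUDIT.md`, `…/g6/TR-CORE-DOORS-g6.md`.
-/

set_option autoImplicit false
set_option linter.dupNamespace false -- the directory name repeats the summit name (sibling precedent)

noncomputable section

open scoped Classical MatrixGroups ModularForm

open CongruenceSubgroup UpperHalfPlane WeierstrassCurve
open Literature.NumberTheory.EllipticCurves Literature.NumberTheory.EllipticCurves.ModularForms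
  Literature.NumberTheory.EllipticCurves.Rank1Residual
  Literature.NumberTheory.EllipticCurves.Rank1Residual.Typed
  Literature.NumberTheory.EllipticCurves.Wuthrich2014
  Literature.NumberTheory.EllipticCurves.SteinWuthrich2013
  Literature.NumberTheory.EllipticCurves.Greenberg1999
  Literature.NumberTheory.EllipticCurves.Kato2004
  Literature.NumberTheory.EllipticCurves.GreenbergVatsal2000
  Literature.NumberTheory.EllipticCurves.EmertonPollackWeston2006
  Literature.NumberTheory.GaloisRepresentations
  Summit.BirchSwinnertonDyer.Rank1Residual
  Summit.BirchSwinnertonDyer.Rank1Residual.X1.MuLambda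
  Summit.BirchSwinnertonDyer.Rank1Residual.X11a
  Summit.BirchSwinnertonDyer.Rank1Residual.X11a.LambdaNorm
  Summit.BirchSwinnertonDyer.Rank1Residual.X11a.Chain

namespace Summit.BirchSwinnertonDyer.BirchSwinnertonDyer.Theorems.OddChain

/-! ### §1 At a pair on the très-ramifié locus (`Surj` automatic): the lower half from a member with the rational
equality and THIRTEEN named facts -/

section Pair

variable {W : WeierstrassCurve ℚ} [W.IsElliptic] [W.IsGloballyMinimal] {p : ℕ} [Fact p.Prime]

/-- **AT AN X11a PAIR WITH `p = 3` AND `3 ∤ ord₃ Δ_min`: `OddChain.MemberRatEqAt W 3` + 13 named facts ⟹ the lower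
half `Typed.MissingLowerBoundAt W 3`.** The image is onto (the tree's `ClassX11a.surj_of_not_dvd`), hence `3`-adically onto by
Wuthrich's Lemma 20 (`h20`, `3² ∤ N`), so the divisibility is Kato–Wuthrich A32 (`hKato`) and the six Kato §17.13 ∕
Thm. 12.4 ∕ Cor. 18 facts of the both-images door are not needed; the certificate `μ^an(E,3) = 0` is x11a line p2's
theorem `MultThreeMuAn.muAnZeroAt_three_of_mult_of_irr` modulo Mazur's Manin constant (`hMz`). PER PAIR; CONDITIONAL
on the facts and on `hmem` (not in print at `3`); closes nothing class-wide. [cite: Wuthrich2014, Lemma 20 (p. 399), Thm. 3 (p. 382)]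
[cite: Mazur1978, Cor. 4.1] [cite: EmertonPollackWeston2006, Thm. 5.1.3] [cite: Miller2011LMS, Def. 1.1] -/
theorem _root_.Summit.BirchSwinnertonDyer.Rank1Residual.ClassX11a.missingLowerBoundAt_three_of_tresRamifie_of_memberRatEqAt_of_facts
    (hNf : exists_isNewformOf)
    (h311 : thm311_cotorsion_weightK_member_ofLevel_odd) (hT1a : thm1_muAlg_of_weightK_member_ofLevel_odd)
    (hT1b : thm513_transfer_from_weightK_member_of_bdd_ofLevel_odd)
    (h61 : DeligneSerre1974.thm61_exists_adicGaloisRep) (h326 : Hida2000_thm326_ordinary)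
    (hKato : kato_charIdeal_dvd_multiplicative_of_surjective)
    (h20 : lemma20_surjective_threeAdic_of_semistable)
    (hJs : thm61_splitMultiplicative) (hJn : thm61_nonsplitMultiplicative)
    (hGZK : rank_eq_analyticRank_of_analyticRank_le_one)
    (hGS : greenberg_stevens (W := W) (p := p))
    (hMz : mazur_not_dvd_maninConstant_of_odd)
    (hX : ClassX11a W p) (hp3 : p = 3) (hΔ : ¬ p ∣ padicValInt p W.minimalDiscriminantInt)
    (hmem : MemberRatEqAt W p) : MissingLowerBoundAt W p := by
  obtain ⟨M, _, hpM, k, g, ι, hmemb, hRat⟩ := hmem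
  have hsurj : Surj W p := hX.surj_of_not_dvd W p hΔ
  subst hp3
  have hμ : X11a.MuAnZeroAt W 3 := MultThreeMuAn.muAnZeroAt_three_of_mult_of_irr hMz W hX.mult hX.irr
  have hsurj' : ∀ n : ℕ, W.HasSurjectiveModNGaloisRep (3 ^ n : ℕ) := h20 W (Or.inr hX.mult) hsurj
  exact hX.missingLowerBoundAt_of_member_of_ratEq_of_surjective_pow hNf h311 hT1a hT1b h61 h326 hKato hJs hJn hGZK
    hGS hsurj' hμ hpM g ι hmemb hRat

/-- **AT AN X11a PAIR WITH `p = 3` AND `3 ∤ ord₃ Δ_min`: X. Wan's Thm. 4 CONCLUSION FOR EVERY good-ordinary member of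
`H(E[3])` (`hrat`, displayed; not in print at `3`) + 13 named facts ⟹ the lower half** — the member fed to the previous
door is the weight-six one (`exists_memberOfLevel_three`, from modularity `hNf`). PER PAIR; CONDITIONAL; closes nothing
class-wide. [cite: Wan2015, Thm. 4 (p. 4: "Suppose that p ⩾ 5")] [cite: EmertonPollackWeston2006, §2.1 and Ex. 5.3.1]
[cite: Miller2011LMS, Def. 1.1] -/
theorem _root_.Summit.BirchSwinnertonDyer.Rank1Residual.ClassX11a.missingLowerBoundAt_three_of_tresRamifie_of_forall_ratEqAtMember_of_facts
    (hNf : exists_isNewformOf)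
    (h311 : thm311_cotorsion_weightK_member_ofLevel_odd) (hT1a : thm1_muAlg_of_weightK_member_ofLevel_odd)
    (hT1b : thm513_transfer_from_weightK_member_of_bdd_ofLevel_odd)
    (h61 : DeligneSerre1974.thm61_exists_adicGaloisRep) (h326 : Hida2000_thm326_ordinary)
    (hKato : kato_charIdeal_dvd_multiplicative_of_surjective)
    (h20 : lemma20_surjective_threeAdic_of_semistable)
    (hJs : thm61_splitMultiplicative) (hJn : thm61_nonsplitMultiplicative)
    (hGZK : rank_eq_analyticRank_of_analyticRank_le_one)
    (hGS : greenberg_stevens (W := W) (p := p))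
    (hMz : mazur_not_dvd_maninConstant_of_odd)
    (hX : ClassX11a W p) (hp3 : p = 3) (hΔ : ¬ p ∣ padicValInt p W.minimalDiscriminantInt)
    (hrat : ∀ {M : ℕ} [NeZero M], ¬ p ∣ M → ∀ {k : ℤ} (g : CuspForm (Gamma0 M) k)
      (ι : coeffField g →+* PadicAlgCl p), IsOrdinaryMemberOfLevel W p g ι → RatEqAtMember p g ι) :
    MissingLowerBoundAt W p := by
  obtain ⟨M, instM, hpM, g, ι, hmemb⟩ := exists_memberOfLevel_three W p hNf hp3 hX.mult
  exact hX.missingLowerBoundAt_three_of_tresRamifie_of_memberRatEqAt_of_facts hNf h311 hT1a hT1b h61 h326 hKato h20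
    hJs hJn hGZK hGS hMz hp3 hΔ ⟨M, instM, hpM, _, g, ι, hmemb, hrat hpM g ι hmemb⟩

end Pair

/-! ### §2 The registered r8 stub `stub_lowerTresRamifieThree`, VERBATIM, from ONE research statement -/

section Stub

/-- **The registered stub `stub_lowerTresRamifieThree` of crux `X11aLowerHalf` (line birth r8; ITS STATEMENT
VERBATIM as the conclusion) from 13 named facts + Greenberg–Stevens + ONE `∀`-hypothesis with the stub's own
binders: «`OddChain.MemberRatEqAt W 3` — some good-ordinary member of `H(E[3])` with the rational cyclotomic equality
`char_Λ X(ℚ_∞, A_g) = (L_p(g))` in `Λ_𝒪 ⊗ ℚ_p` — at every très-ramifié off-Kodaira deep X11a pair at `3`»** (X. Wan's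
Thm. 4 at `p = 3` for one member per pair: NOT in print). The `p = 3` open core of the crux is exactly `hmem`.
CONDITIONAL; closes nothing by itself. [cite: Wan2015, Thm. 4 (p. 4: "Suppose that p ⩾ 5")]
[cite: EmertonPollackWeston2006, Thm. 1, Thm. 3.1.1, Thm. 5.1.3] [cite: Wuthrich2014, Lemma 20 (p. 399)]
[cite: Mazur1978, Cor. 4.1] [cite: Miller2011LMS, Def. 1.1] -/
theorem tresRamifieThree_of_forall_memberRatEqAt_of_facts
    (hNf : exists_isNewformOf)
    (h311 : thm311_cotorsion_weightK_member_ofLevel_odd) (hT1a : thm1_muAlg_of_weightK_member_ofLevel_odd)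
    (hT1b : thm513_transfer_from_weightK_member_of_bdd_ofLevel_odd)
    (h61 : DeligneSerre1974.thm61_exists_adicGaloisRep) (h326 : Hida2000_thm326_ordinary)
    (hKato : kato_charIdeal_dvd_multiplicative_of_surjective)
    (h20 : lemma20_surjective_threeAdic_of_semistable)
    (hJs : thm61_splitMultiplicative) (hJn : thm61_nonsplitMultiplicative)
    (hGZK : rank_eq_analyticRank_of_analyticRank_le_one)
    (hGS : ∀ (W : WeierstrassCurve ℚ) [W.IsElliptic] [W.IsGloballyMinimal] (p : ℕ) [Fact p.Prime],
      greenberg_stevens (W := W) (p := p))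
    (hMz : mazur_not_dvd_maninConstant_of_odd)
    (hmem : ∀ (W : WeierstrassCurve ℚ) [W.IsElliptic] [W.IsGloballyMinimal] (p : ℕ) [Fact p.Prime],
      ClassX11a W p → p = 3 → ¬ X11a.ShaAnUnit W p →
      ¬ (Surj W p ∧ ∃ v : IsDedekindDomain.HeightOneSpectrum ℤ, W.HasAdditiveReductionAt v ∧
          3 ∣ (W.kodairaSymbolAt v).componentGroupOrder ∧
          ¬ Rat.HeightOneSpectrum.natGenerator v ^ 3 ∣ W.conductorNorm ℤ) →
      ¬ p ∣ padicValInt p W.minimalDiscriminantInt → MemberRatEqAt W p) :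
    ∀ (W : WeierstrassCurve ℚ) [W.IsElliptic] [W.IsGloballyMinimal] (p : ℕ) [Fact p.Prime],
      ClassX11a W p → p = 3 → ¬ X11a.ShaAnUnit W p →
      ¬ (Surj W p ∧ ∃ v : IsDedekindDomain.HeightOneSpectrum ℤ, W.HasAdditiveReductionAt v ∧
          3 ∣ (W.kodairaSymbolAt v).componentGroupOrder ∧
          ¬ Rat.HeightOneSpectrum.natGenerator v ^ 3 ∣ W.conductorNorm ℤ) →
      ¬ p ∣ padicValInt p W.minimalDiscriminantInt → MissingLowerBoundAt W p :=
  fun W _ _ p _ hX hp3 hu hK hΔ =>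
    hX.missingLowerBoundAt_three_of_tresRamifie_of_memberRatEqAt_of_facts hNf h311 hT1a hT1b h61 h326 hKato h20 hJs
      hJn hGZK (hGS W p) hMz hp3 hΔ (hmem W p hX hp3 hu hK hΔ)

/-- **The registered stub `stub_lowerTresRamifieThree` (VERBATIM) from 13 named facts + Greenberg–Stevens + «X. Wan's
Thm. 4 shape AT `p = 3` on the très-ramifié multiplicative irreducible locus»** (`hWan3`: for every globally minimal
`E/ℚ` with multiplicative reduction at `3`, `E[3]` irreducible and `3 ∤ ord₃ Δ_min`, every good-ordinary member
`(g, ι)` of `H(E[3])` of level `M`, `3 ∤ M`, has `RatEqAtMember 3 g ι` — the fact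
`Wan2015.thm4_rational_weightK_member_of_bdd_ofLevel_irred` with its printed binder `5 ≤ p` replaced; NOT a theorem in
print, displayed as a hypothesis and never as a fact). Members exist by modularity (`exists_memberOfLevel_three`).
CONDITIONAL; closes nothing by itself. [cite: Wan2015, Thm. 4 (pp. 4–5) = Thm. 103 (pp. 91–92)]
[cite: EmertonPollackWeston2006, §2.1, Thm. 5.1.3] [cite: Wuthrich2014, Lemma 20 (p. 399)] [cite: Miller2011LMS, Def. 1.1] -/
theorem tresRamifieThree_of_wanShapeThree_of_facts
    (hNf : exists_isNewformOf)
    (h311 : thm311_cotorsion_weightK_member_ofLevel_odd) (hT1a : thm1_muAlg_of_weightK_member_ofLevel_odd)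
    (hT1b : thm513_transfer_from_weightK_member_of_bdd_ofLevel_odd)
    (h61 : DeligneSerre1974.thm61_exists_adicGaloisRep) (h326 : Hida2000_thm326_ordinary)
    (hKato : kato_charIdeal_dvd_multiplicative_of_surjective)
    (h20 : lemma20_surjective_threeAdic_of_semistable)
    (hJs : thm61_splitMultiplicative) (hJn : thm61_nonsplitMultiplicative)
    (hGZK : rank_eq_analyticRank_of_analyticRank_le_one)
    (hGS : ∀ (W : WeierstrassCurve ℚ) [W.IsElliptic] [W.IsGloballyMinimal] (p : ℕ) [Fact p.Prime],
      greenberg_stevens (W := W) (p := p))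
    (hMz : mazur_not_dvd_maninConstant_of_odd)
    (hWan3 : ∀ (W : WeierstrassCurve ℚ) [W.IsElliptic] [W.IsGloballyMinimal] (p : ℕ) [Fact p.Prime],
      p = 3 → W.HasMultiplicativeReductionAtPrime p → W.HasIrreducibleModPGaloisRep p →
      ¬ p ∣ padicValInt p W.minimalDiscriminantInt →
      ∀ {M : ℕ} [NeZero M], ¬ p ∣ M → ∀ {k : ℤ} (g : CuspForm (Gamma0 M) k)
        (ι : coeffField g →+* PadicAlgCl p), IsOrdinaryMemberOfLevel W p g ι → RatEqAtMember p g ι) :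
    ∀ (W : WeierstrassCurve ℚ) [W.IsElliptic] [W.IsGloballyMinimal] (p : ℕ) [Fact p.Prime],
      ClassX11a W p → p = 3 → ¬ X11a.ShaAnUnit W p →
      ¬ (Surj W p ∧ ∃ v : IsDedekindDomain.HeightOneSpectrum ℤ, W.HasAdditiveReductionAt v ∧
          3 ∣ (W.kodairaSymbolAt v).componentGroupOrder ∧
          ¬ Rat.HeightOneSpectrum.natGenerator v ^ 3 ∣ W.conductorNorm ℤ) →
      ¬ p ∣ padicValInt p W.minimalDiscriminantInt → MissingLowerBoundAt W p :=
  fun W _ _ p _ hX hp3 _ _ hΔ =>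
    hX.missingLowerBoundAt_three_of_tresRamifie_of_forall_ratEqAtMember_of_facts hNf h311 hT1a hT1b h61 h326 hKato
      h20 hJs hJn hGZK (hGS W p) hMz hp3 hΔ
      (fun hpM => fun g ι hmemb => hWan3 W p hp3 hX.mult hX.irr hΔ hpM g ι hmemb)

/-- **The registered stub `stub_lowerTresRamifieThree` is EQUIVALENT to its `Surj`-free normal form** (the binder
`¬ (Surj W p ∧ Kodaira)` may be read `¬ Kodaira`, since `Surj W p` holds on the locus: the tree's `ClassX11a.surj_of_not_dvd`).
Pure logic + the tree's transvection theorem; no named fact; closes nothing. [cite: SilvermanATAEC1994, V.6 Prop. 6.1 (p. 410)]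
[cite: Miller2011LMS, Def. 1.1] -/
theorem tresRamifieThree_iff_offKodaira :
    (∀ (W : WeierstrassCurve ℚ) [W.IsElliptic] [W.IsGloballyMinimal] (p : ℕ) [Fact p.Prime],
      ClassX11a W p → p = 3 → ¬ X11a.ShaAnUnit W p →
      ¬ (Surj W p ∧ ∃ v : IsDedekindDomain.HeightOneSpectrum ℤ, W.HasAdditiveReductionAt v ∧
          3 ∣ (W.kodairaSymbolAt v).componentGroupOrder ∧
          ¬ Rat.HeightOneSpectrum.natGenerator v ^ 3 ∣ W.conductorNorm ℤ) →
      ¬ p ∣ padicValInt p W.minimalDiscriminantInt → MissingLowerBoundAt W p) ↔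
    ∀ (W : WeierstrassCurve ℚ) [W.IsElliptic] [W.IsGloballyMinimal] (p : ℕ) [Fact p.Prime],
      ClassX11a W p → p = 3 → ¬ X11a.ShaAnUnit W p →
      ¬ (∃ v : IsDedekindDomain.HeightOneSpectrum ℤ, W.HasAdditiveReductionAt v ∧
          3 ∣ (W.kodairaSymbolAt v).componentGroupOrder ∧
          ¬ Rat.HeightOneSpectrum.natGenerator v ^ 3 ∣ W.conductorNorm ℤ) →
      ¬ p ∣ padicValInt p W.minimalDiscriminantInt → MissingLowerBoundAt W p := by
  constructor
  · intro h W _ _ p _ hX hp3 hu hK hΔ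
    exact h W p hX hp3 hu (fun hsK => hK hsK.2) hΔ
  · intro h W _ _ p _ hX hp3 hu hsK hΔ
    exact h W p hX hp3 hu (fun hK => hsK ⟨hX.surj_of_not_dvd W p hΔ, hK⟩) hΔ

end Stub


/-! ### §3 (appended) Wuthrich's Lemma 20 is a THEOREM of the tree — the same doors from TWELVE named facts

Line birth r9 (lead g3, 12:38Z) discharged the conjunct `Wuthrich2014.lemma20_surjective_threeAdic_of_semistable` of the print bundle by
the tree theorem `Wuthrich2014.lemma20_surjective_threeAdic_of_semistable_holds`
(`Literature/…/Wuthrich2014/ThreeAdicImageSupersingularProofs.lean`); the doors of §1–§2 with their binder `h20` fed by that theorem. -/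

section TwelveFacts

/-- **AT AN X11a PAIR WITH `p = 3` AND `3 ∤ ord₃ Δ_min`: `OddChain.MemberRatEqAt W 3` + TWELVE named facts ⟹ the lower half** —
`ClassX11a.missingLowerBoundAt_three_of_tresRamifie_of_memberRatEqAt_of_facts` with Wuthrich's Lemma 20 supplied by the tree theorem
`Wuthrich2014.lemma20_surjective_threeAdic_of_semistable_holds`. PER PAIR; CONDITIONAL on the facts and on `hmem` (not in print at `3`);
closes nothing class-wide. [cite: Wuthrich2014, Lemma 20 (p. 399), Thm. 3 (p. 382)] [cite: Mazur1978, Cor. 4.1]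
[cite: EmertonPollackWeston2006, Thm. 5.1.3] [cite: Miller2011LMS, Def. 1.1] -/
theorem _root_.Summit.BirchSwinnertonDyer.Rank1Residual.ClassX11a.missingLowerBoundAt_three_of_tresRamifie_of_memberRatEqAt_of_twelveFacts
    {W : WeierstrassCurve ℚ} [W.IsElliptic] [W.IsGloballyMinimal] {p : ℕ} [Fact p.Prime]
    (hNf : exists_isNewformOf)
    (h311 : thm311_cotorsion_weightK_member_ofLevel_odd) (hT1a : thm1_muAlg_of_weightK_member_ofLevel_odd)
    (hT1b : thm513_transfer_from_weightK_member_of_bdd_ofLevel_odd)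
    (h61 : DeligneSerre1974.thm61_exists_adicGaloisRep) (h326 : Hida2000_thm326_ordinary)
    (hKato : kato_charIdeal_dvd_multiplicative_of_surjective)
    (hJs : thm61_splitMultiplicative) (hJn : thm61_nonsplitMultiplicative)
    (hGZK : rank_eq_analyticRank_of_analyticRank_le_one)
    (hGS : greenberg_stevens (W := W) (p := p))
    (hMz : mazur_not_dvd_maninConstant_of_odd)
    (hX : ClassX11a W p) (hp3 : p = 3) (hΔ : ¬ p ∣ padicValInt p W.minimalDiscriminantInt)
    (hmem : MemberRatEqAt W p) : MissingLowerBoundAt W p :=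
  hX.missingLowerBoundAt_three_of_tresRamifie_of_memberRatEqAt_of_facts hNf h311 hT1a hT1b h61 h326 hKato
    Wuthrich2014.lemma20_surjective_threeAdic_of_semistable_holds hJs hJn hGZK hGS hMz hp3 hΔ hmem

/-- **The registered stub `stub_lowerTresRamifieThree` (line birth r8 = r9, ITS STATEMENT VERBATIM) from TWELVE named facts
(Greenberg–Stevens among them) + ONE `∀`-hypothesis «`OddChain.MemberRatEqAt W 3` on the stub's own locus»** — `tresRamifieThree_of_forall_memberRatEqAt_of_facts`
with Wuthrich's Lemma 20 supplied by the tree theorem. CONDITIONAL; closes nothing by itself.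
[cite: Wan2015, Thm. 4 (p. 4: "Suppose that p ⩾ 5")] [cite: Wuthrich2014, Lemma 20 (p. 399)] [cite: Miller2011LMS, Def. 1.1] -/
theorem tresRamifieThree_of_forall_memberRatEqAt_of_twelveFacts
    (hNf : exists_isNewformOf)
    (h311 : thm311_cotorsion_weightK_member_ofLevel_odd) (hT1a : thm1_muAlg_of_weightK_member_ofLevel_odd)
    (hT1b : thm513_transfer_from_weightK_member_of_bdd_ofLevel_odd)
    (h61 : DeligneSerre1974.thm61_exists_adicGaloisRep) (h326 : Hida2000_thm326_ordinary)
    (hKato : kato_charIdeal_dvd_multiplicative_of_surjective)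
    (hJs : thm61_splitMultiplicative) (hJn : thm61_nonsplitMultiplicative)
    (hGZK : rank_eq_analyticRank_of_analyticRank_le_one)
    (hGS : ∀ (W : WeierstrassCurve ℚ) [W.IsElliptic] [W.IsGloballyMinimal] (p : ℕ) [Fact p.Prime],
      greenberg_stevens (W := W) (p := p))
    (hMz : mazur_not_dvd_maninConstant_of_odd)
    (hmem : ∀ (W : WeierstrassCurve ℚ) [W.IsElliptic] [W.IsGloballyMinimal] (p : ℕ) [Fact p.Prime],
      ClassX11a W p → p = 3 → ¬ X11a.ShaAnUnit W p →
      ¬ (Surj W p ∧ ∃ v : IsDedekindDomain.HeightOneSpectrum ℤ, W.HasAdditiveReductionAt v ∧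
          3 ∣ (W.kodairaSymbolAt v).componentGroupOrder ∧
          ¬ Rat.HeightOneSpectrum.natGenerator v ^ 3 ∣ W.conductorNorm ℤ) →
      ¬ p ∣ padicValInt p W.minimalDiscriminantInt → MemberRatEqAt W p) :
    ∀ (W : WeierstrassCurve ℚ) [W.IsElliptic] [W.IsGloballyMinimal] (p : ℕ) [Fact p.Prime],
      ClassX11a W p → p = 3 → ¬ X11a.ShaAnUnit W p →
      ¬ (Surj W p ∧ ∃ v : IsDedekindDomain.HeightOneSpectrum ℤ, W.HasAdditiveReductionAt v ∧
          3 ∣ (W.kodairaSymbolAt v).componentGroupOrder ∧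
          ¬ Rat.HeightOneSpectrum.natGenerator v ^ 3 ∣ W.conductorNorm ℤ) →
      ¬ p ∣ padicValInt p W.minimalDiscriminantInt → MissingLowerBoundAt W p :=
  tresRamifieThree_of_forall_memberRatEqAt_of_facts hNf h311 hT1a hT1b h61 h326 hKato
    Wuthrich2014.lemma20_surjective_threeAdic_of_semistable_holds hJs hJn hGZK hGS hMz hmem

/-- **The registered stub `stub_lowerTresRamifieThree` (VERBATIM) from TWELVE named facts (Greenberg–Stevens among them) + «X. Wan's Thm. 4 shape
AT `p = 3` on the très-ramifié multiplicative irreducible locus» (`hWan3`, displayed; NOT in print)** — `tresRamifieThree_of_wanShapeThree_of_facts`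
with Wuthrich's Lemma 20 supplied by the tree theorem. CONDITIONAL; closes nothing by itself.
[cite: Wan2015, Thm. 4 (pp. 4–5) = Thm. 103 (pp. 91–92)] [cite: Wuthrich2014, Lemma 20 (p. 399)] [cite: Miller2011LMS, Def. 1.1] -/
theorem tresRamifieThree_of_wanShapeThree_of_twelveFacts
    (hNf : exists_isNewformOf)
    (h311 : thm311_cotorsion_weightK_member_ofLevel_odd) (hT1a : thm1_muAlg_of_weightK_member_ofLevel_odd)
    (hT1b : thm513_transfer_from_weightK_member_of_bdd_ofLevel_odd)
    (h61 : DeligneSerre1974.thm61_exists_adicGaloisRep) (h326 : Hida2000_thm326_ordinary)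
    (hKato : kato_charIdeal_dvd_multiplicative_of_surjective)
    (hJs : thm61_splitMultiplicative) (hJn : thm61_nonsplitMultiplicative)
    (hGZK : rank_eq_analyticRank_of_analyticRank_le_one)
    (hGS : ∀ (W : WeierstrassCurve ℚ) [W.IsElliptic] [W.IsGloballyMinimal] (p : ℕ) [Fact p.Prime],
      greenberg_stevens (W := W) (p := p))
    (hMz : mazur_not_dvd_maninConstant_of_odd)
    (hWan3 : ∀ (W : WeierstrassCurve ℚ) [W.IsElliptic] [W.IsGloballyMinimal] (p : ℕ) [Fact p.Prime],
      p = 3 → W.HasMultiplicativeReductionAtPrime p → W.HasIrreducibleModPGaloisRep p →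
      ¬ p ∣ padicValInt p W.minimalDiscriminantInt →
      ∀ {M : ℕ} [NeZero M], ¬ p ∣ M → ∀ {k : ℤ} (g : CuspForm (Gamma0 M) k)
        (ι : coeffField g →+* PadicAlgCl p), IsOrdinaryMemberOfLevel W p g ι → RatEqAtMember p g ι) :
    ∀ (W : WeierstrassCurve ℚ) [W.IsElliptic] [W.IsGloballyMinimal] (p : ℕ) [Fact p.Prime],
      ClassX11a W p → p = 3 → ¬ X11a.ShaAnUnit W p →
      ¬ (Surj W p ∧ ∃ v : IsDedekindDomain.HeightOneSpectrum ℤ, W.HasAdditiveReductionAt v ∧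
          3 ∣ (W.kodairaSymbolAt v).componentGroupOrder ∧
          ¬ Rat.HeightOneSpectrum.natGenerator v ^ 3 ∣ W.conductorNorm ℤ) →
      ¬ p ∣ padicValInt p W.minimalDiscriminantInt → MissingLowerBoundAt W p :=
  tresRamifieThree_of_wanShapeThree_of_facts hNf h311 hT1a hT1b h61 h326 hKato
    Wuthrich2014.lemma20_surjective_threeAdic_of_semistable_holds hJs hJn hGZK hGS hMz hWan3

end TwelveFacts

end Summit.BirchSwinnertonDyer.BirchSwinnertonDyer.Theorems.OddChain

end
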